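import Summits.Schanuel.Schanuel.Theorems.ZilberEacMovingLineFast
import Summits.Schanuel.Schanuel.Theorems.ZilberEacMovingLineMM
import HarnessLib

/-!
# The moving-target line family: density for EVERY slope `a ∉ ℚ` and EVERY fibre polynomial `F`

Zilber's Exponential-Algebraic Closedness, case ladder (host summit Schanuel, cell `pub-schanuel`,
seat 2, gen 8).  Conclusion of the `ZilberEacMovingLine*` series on the NON-SPLIT surfaces
`W(a, b; A, F) = {x₁ = a x₀ + b, y₀ = A(x₀) + y₁ F(y₁)} ⊆ ℂ² × ℂ²` (`deg A ≥ 1`; exponential points =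
solutions of `e^{z} = A(z) + e^{a z + b} F(e^{a z + b})`):

* `unprojectedDense_movingLine_real_fast` — density in the FAST regime `a (1 + deg F) > 1` (real
  irrational `a`, `F ≠ 0`): along the solutions of `ZilberEacMovingLineFast`
  `log |y₀| = (d/(ea)) log k + O(1)`, `log |y₁| = (d/e) log k + O(1)` (`e = 1 + deg F`), exponents in
  ratio `1 : a`; THEOREM I.
* `unprojectedDense_movingLine_real_all` — EVERY `a ∈ ℝ ∖ ℚ`, every `b`, `deg A ≥ 1`, EVERY `F`
  (slow regime / fast regime / `F = 0`; the borderline `a (1 + deg F) = 1` is rational).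
* `unprojectedDense_movingLine` — EVERY `a ∈ ℂ ∖ ℚ` (non-real slopes: THEOREM G).
* `unprojectedDense_movingLine_of_mmCase`, `mmCase_and_dense_movingLine_iff`,
  `unprojectedDensityQuestion_instance_movingLine`: **Mantova–Masser's typed density question
  (`MMCaseDimPiOneFree W → UnprojectedDense W`) HOLDS on the whole 4-parameter non-split family
  `W(a, b; A, F)`**, all of whose members with `a ∉ ℚ` are in the case, multiplicatively free and
  rotund (members of the FREE question `⟺ ECCellPeriodicStdFib 2`).
* `exists_exp_eq_movingLine` — in particular `e^{z} = A(z) + e^{az+b} F(e^{az+b})` is solvable for every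
  `a ∉ ℚ`, `deg A ≥ 1`; e.g. `e^{z} = z + e^{√2 z}(e^{√2 z} + 1)` (fast regime).

HONEST FRAMING: explicit families of instances of an OPEN question (MM24 §1 Further remarks); the
general free question, non-line bases, `x`-dependent `F`, and `EC(3,2)` remain OPEN; NOT Schanuel's
conjecture; EAC ⇏ SC.
-/

noncomputable section

open Complex MvPolynomial Filter Topology
open Literature.NumberTheory.Transcendental Literature.ModelTheory.Zilber

set_option linter.dupNamespace false

namespace Summit.Schanuel.Schanuel.Theorems

/-! ## Part 1. Density in the fast regime -/

section FastDensity

/-- **Density in the fast regime.**  For `a ∈ ℝ ∖ ℚ`, `b ∈ ℂ`, `deg A ≥ 1`, `F ≠ 0` with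
`a (1 + deg F) > 1`, the exponential points of `W(a, b; A, F)` are ZARISKI DENSE.  Along the solutions
of `eventually_exists_solution_realLine_fast` (`W` within `1/2` of `2πi k + log Â(2πi k)`,
`z = W/(ea) - b/a`, `a z + b = W/e`): `log |y₀| = Re z = (d/(ea)) log k + O(1)` and
`log |y₁| = Re W / e = (d/e) log k + O(1)`; THEOREM I with exponents `d/(ea)` and `a · d/(ea)`. (new)
[cite: MantovaMasser2023, §1 Further remarks] -/
theorem unprojectedDense_movingLine_real_fast {a : ℝ} (ha : Irrational a) (b : ℂ)
    {A : Polynomial ℂ} (hA : 0 < A.natDegree) {F : Polynomial ℂ} (hF : F ≠ 0)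
    (hfast : 1 < a * (F.natDegree + 1)) : UnprojectedDense (movingLineSurface a b A F) := by
  classical
  set e : ℕ := F.natDegree + 1 with he
  have hepos : (0 : ℝ) < e := by positivity
  have hapos : 0 < a := by
    by_contra h
    have : a * (F.natDegree + 1) ≤ 0 := mul_nonpos_of_nonpos_of_nonneg (not_lt.1 h) (by positivity)
    linarith
  have ha0 : (a : ℂ) ≠ 0 := by exact_mod_cast hapos.ne'
  have he0 : (e : ℂ) ≠ 0 := by exact_mod_cast (show e ≠ 0 by positivity)
  set κ : ℝ := ((e : ℝ) * a)⁻¹ with hκ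
  have hκpos : 0 < κ := by rw [hκ]; positivity
  set Ah : Polynomial ℂ := fastPoly a b A F with hAh
  have hdegAh : Ah.natDegree = A.natDegree := natDegree_fastPoly hapos.ne' b A hF
  have hAh0 : Ah ≠ 0 := by
    intro h
    rw [h, Polynomial.natDegree_zero] at hdegAh
    omega
  -- solutions and control
  obtain ⟨C, t₀, ht₀, hctrl⟩ := latticeCentre_control hAh0 (one_ne_zero : (1 : ℤ) ≠ 0)
  have hsol := eventually_exists_solution_realLine_fast b hA hF hfast
  obtain ⟨k₀, hk₀⟩ := eventually_atTop.1
    (hsol.and (tendsto_natCast_atTop_atTop.eventually_ge_atTop t₀))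
  have hsol' : ∀ k : ℕ, ∃ W : ℂ,
      ‖W - (((max k k₀ : ℕ) : ℂ) * (2 * Real.pi * I * ((1 : ℤ) : ℂ)) +
        log (Ah.eval (((max k k₀ : ℕ) : ℂ) * (2 * Real.pi * I * ((1 : ℤ) : ℂ)))))‖ ≤ 1 / 2 ∧
      exp ((κ : ℂ) * W + -(b / a)) = A.eval ((κ : ℂ) * W + -(b / a)) +
        exp (W / (e : ℂ)) * F.eval (exp (W / (e : ℂ))) :=
    fun k => (hk₀ (max k k₀) (le_max_right _ _)).1
  choose Ws hWs using hsol'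
  set x : ℕ → ℂ := fun k => (κ : ℂ) * Ws k + -(b / a) with hx
  have hax : ∀ k, (a : ℂ) * x k + b = Ws k / (e : ℂ) := by
    intro k
    have hκ' : (κ : ℂ) = (((e : ℝ) : ℂ) * a)⁻¹ := by rw [hκ]; push_cast; rfl
    rw [hx]
    simp only [hκ']
    have : ((e : ℝ) : ℂ) = (e : ℂ) := by push_cast; rfl
    rw [this]
    field_simp
    ring
  -- the exponential points
  set p : ℕ → Fin 2 ⊕ Fin 2 → ℂ := fun k => mlPoint a b (x k) with hp
  have hpS : ∀ k, p k ∈ movingLineSurface a b A F := by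
    intro k
    rw [hp, mlPoint_mem_iff, hax k]
    exact (hWs k).2
  have hpΓ : ∀ k, p k ∈ expGraph ℂ 2 := fun k => mlPoint_mem_expGraph _ _ _
  set T : ℕ → ℝ := fun k => Real.log ((max k k₀ : ℕ) : ℝ) with hT
  have hTlim : Tendsto T atTop atTop := by
    refine Real.tendsto_log_atTop.comp (tendsto_natCast_atTop_atTop.comp ?_)
    exact tendsto_atTop_mono (fun k => le_max_left k k₀) tendsto_id
  have hbound : ∀ k, |(Ws k).re - A.natDegree * T k| ≤ C := by
    intro k
    have h := (hctrl (max k k₀) (hk₀ _ (le_max_right _ _)).2 (Ws k) (hWs k).1).1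
    rwa [hdegAh] at h
  have hC0 : 0 ≤ C := (abs_nonneg _).trans (hbound 0)
  set d' : ℝ := κ * A.natDegree with hd'
  have hd'0 : d' ≠ 0 := by
    have : (0 : ℝ) < A.natDegree := by exact_mod_cast hA
    rw [hd']; positivity
  have had' : a * d' = A.natDegree / e := by
    rw [hd', hκ]
    field_simp
  refine unprojectedDense_of_logGrowth_irrational (isIrreducibleClosed_movingLineSurface _ _ _ _)
    (zariskiDim_movingLineSurface _ _ _ _).le (Sum.inr 0) (Sum.inr 1) hpS hpΓ hTlim ha hd'0
    (E := κ * C + |(b / a).re| + C) (Eventually.of_forall fun k => ⟨exp_ne_zero _, ?_⟩)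
    (Eventually.of_forall fun k => ⟨exp_ne_zero _, ?_⟩)
  · -- `log |y₀| = Re z = κ Re W - Re (b/a)`
    simp only [hp, mlPoint_inr_zero, Complex.norm_exp, Real.log_exp, hx, Complex.add_re,
      Complex.re_ofReal_mul, Complex.neg_re]
    have h := hbound k
    have e1 : κ * (Ws k).re + -(b / ↑a).re - d' * T k = κ * ((Ws k).re - A.natDegree * T k) - (b / a).re := by
      rw [hd']; ring
    rw [e1]
    calc |κ * ((Ws k).re - A.natDegree * T k) - (b / ↑a).re|
        ≤ |κ * ((Ws k).re - A.natDegree * T k)| + |(b / ↑a).re| := abs_sub _ _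
      _ = κ * |(Ws k).re - A.natDegree * T k| + |(b / ↑a).re| := by
          rw [abs_mul, abs_of_pos hκpos]
      _ ≤ κ * C + |(b / ↑a).re| := by gcongr
      _ ≤ κ * C + |(b / ↑a).re| + C := by linarith
  · -- `log |y₁| = Re (W / e)`
    simp only [hp, mlPoint_inr_one, Complex.norm_exp, Real.log_exp]
    rw [hax k, had']
    have hre : (Ws k / (e : ℂ)).re = (Ws k).re / e := by
      rw [show (e : ℂ) = ((e : ℝ) : ℂ) by push_cast; rfl, Complex.div_ofReal_re]
    rw [hre]
    have h := hbound k
    have e1 : (Ws k).re / e - A.natDegree / e * T k = ((Ws k).re - A.natDegree * T k) / e := by ring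
    rw [e1, abs_div, abs_of_pos hepos]
    have he1 : (1 : ℝ) ≤ e := by rw [he]; exact_mod_cast Nat.succ_le_succ (Nat.zero_le _)
    calc |(Ws k).re - A.natDegree * T k| / e ≤ |(Ws k).re - A.natDegree * T k| :=
          div_le_self (abs_nonneg _) he1
      _ ≤ C := h
      _ ≤ κ * C + |(b / ↑a).re| + C := by
          have : 0 ≤ κ * C := by positivity
          have : 0 ≤ |(b / ↑a).re| := abs_nonneg _
          linarith

end FastDensity

/-! ## Part 2. Every slope, every fibre polynomial -/

section All

/-- **EVERY real irrational slope, EVERY fibre polynomial.**  For `a ∈ ℝ ∖ ℚ`, `b ∈ ℂ`, `deg A ≥ 1`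
and any `F ∈ ℂ[u]` the exponential points of `W(a, b; A, F)` are Zariski dense: `F = 0` by the pure
moving target, `a (1 + deg F) < 1` by the slow regime (THEOREM R⁺), `a (1 + deg F) > 1` by the fast
regime; equality is excluded since `a ∉ ℚ`. (new) [cite: MantovaMasser2023, §1 Further remarks] -/
theorem unprojectedDense_movingLine_real_all {a : ℝ} (ha : Irrational a) (b : ℂ) {A : Polynomial ℂ}
    (hA : 0 < A.natDegree) (F : Polynomial ℂ) : UnprojectedDense (movingLineSurface a b A F) := by
  by_cases hF : F = 0
  · subst hF
    exact unprojectedDense_movingLine_real_zero ha b hA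
  have hne : a * (F.natDegree + 1) ≠ 1 := by
    intro h
    apply ha
    refine ⟨((F.natDegree + 1 : ℕ) : ℚ)⁻¹, ?_⟩
    have hf0 : ((F.natDegree : ℝ) + 1) ≠ 0 := by positivity
    push_cast
    field_simp
    linarith
  rcases lt_or_gt_of_ne hne with hlt | hgt
  · refine unprojectedDense_movingLine_real ha b hA F ?_
    have hd : (0 : ℝ) < A.natDegree := by exact_mod_cast hA
    by_cases hpos : 0 ≤ a
    · rw [max_eq_left (by positivity : 0 ≤ a * A.natDegree)]
      have : a * (F.natDegree + 1) * A.natDegree < 1 * A.natDegree :=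
        mul_lt_mul_of_pos_right hlt hd
      nlinarith
    · push Not at hpos
      have h1 : a * A.natDegree ≤ 0 := by nlinarith
      rw [max_eq_right h1, zero_mul, add_zero]
      nlinarith
  · exact unprojectedDense_movingLine_real_fast ha b hA hF hgt

/-- **EVERY slope `a ∈ ℂ ∖ ℚ`, EVERY fibre polynomial**: the exponential points of
`W(a, b; A, F) = {x₁ = a x₀ + b, y₀ = A(x₀) + y₁ F(y₁)}` (`deg A ≥ 1`) are Zariski dense. (new)
[cite: MantovaMasser2023, §1 Further remarks] -/
theorem unprojectedDense_movingLine {a : ℂ} (ha : ∀ r : ℚ, a ≠ (r : ℂ)) (b : ℂ) {A : Polynomial ℂ}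
    (hA : 0 < A.natDegree) (F : Polynomial ℂ) : UnprojectedDense (movingLineSurface a b A F) := by
  have hA0 : A ≠ 0 := by rintro rfl; simp at hA
  by_cases him : a.im = 0
  · have hare : a = ((a.re : ℝ) : ℂ) := by
      apply Complex.ext <;> simp [him]
    rw [hare] at ha ⊢
    exact unprojectedDense_movingLine_real_all (irrational_of_forall_rat_ne ha) b hA F
  · exact unprojectedDense_movingLine_of_im_ne_zero him b hA0 F

/-- **Mantova–Masser's typed density question HOLDS on the whole non-split family `W(a, b; A, F)`**
(`deg A ≥ 1`; `a, b ∈ ℂ`, `F ∈ ℂ[u]` arbitrary): case (dim-pi-S-1-free) implies Zariski density of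
the exponential points. (new) [cite: MantovaMasser2023, §1 Further remarks] -/
theorem unprojectedDense_movingLine_of_mmCase {a : ℂ} (b : ℂ) {A : Polynomial ℂ}
    (hA : 0 < A.natDegree) (F : Polynomial ℂ) (h : MMCaseDimPiOneFree (movingLineSurface a b A F)) :
    UnprojectedDense (movingLineSurface a b A F) :=
  unprojectedDense_movingLine ((mmCase_movingLineSurface_iff a b hA F).1 h) b hA F

/-- On the family, "in the case" and "in the case with dense exponential points" coincide and both
mean `a ∉ ℚ`. (new) -/
theorem mmCase_and_dense_movingLine_iff (a b : ℂ) {A : Polynomial ℂ} (hA : 0 < A.natDegree)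
    (F : Polynomial ℂ) :
    (MMCaseDimPiOneFree (movingLineSurface a b A F) ∧ UnprojectedDense (movingLineSurface a b A F)) ↔
      ∀ r : ℚ, a ≠ (r : ℂ) :=
  ⟨fun h => (mmCase_movingLineSurface_iff a b hA F).1 h.1, fun ha =>
    ⟨mmCase_movingLineSurface ha b hA F, unprojectedDense_movingLine ha b hA F⟩⟩

/-- **Positive instances of the FREE typed question** (`⟺ ECCellPeriodicStdFib 2`): case ∧ free ∧
dense for every member of the family with `a ∉ ℚ`. (new) -/
theorem unprojectedDensityQuestion_instance_movingLine {a : ℂ} (ha : ∀ r : ℚ, a ≠ (r : ℂ)) (b : ℂ)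
    {A : Polynomial ℂ} (hA : 0 < A.natDegree) (F : Polynomial ℂ) :
    MMCaseDimPiOneFree (movingLineSurface a b A F) ∧
      IsMulFree ℂ 2 (movingLineSurface a b A F ∩ torusLocus ℂ 2) ∧
      UnprojectedDense (movingLineSurface a b A F) :=
  ⟨mmCase_movingLineSurface ha b hA F, isMulFree_movingLineSurface a b hA F,
    unprojectedDense_movingLine ha b hA F⟩

/-- **Existence corollary**: `e^{z} = A(z) + e^{a z + b} F(e^{a z + b})` is solvable for every
`a ∈ ℂ ∖ ℚ`, `b ∈ ℂ`, `deg A ≥ 1`, `F ∈ ℂ[u]` (density forces existence). (new) -/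
theorem exists_exp_eq_movingLine {a : ℂ} (ha : ∀ r : ℚ, a ≠ (r : ℂ)) (b : ℂ) {A : Polynomial ℂ}
    (hA : 0 < A.natDegree) (F : Polynomial ℂ) :
    ∃ z : ℂ, exp z = A.eval z + exp (a * z + b) * F.eval (exp (a * z + b)) := by
  obtain ⟨p, hpW, hpΓ⟩ := inter_expGraph_nonempty_of_vanishingIdeal_eq
    (movingLineSurface_inter_torusLocus_nonempty a b hA F).left (unprojectedDense_movingLine ha b hA F)
  refine ⟨p (Sum.inl 0), ?_⟩
  rw [mem_movingLineSurface_iff] at hpW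
  rw [mem_expGraph_iff] at hpΓ
  have h0 := hpΓ 0
  have h1 := hpΓ 1
  rw [Literature.ModelTheory.ExponentialFields.ExponentialRing.complex_exp_eq] at h0 h1
  rw [← h0, hpW.2, h1, hpW.1]

end All

/-! ## Part 3. Examples in the fast regime -/

section Examples

/-- **`e^{z} = z + e^{√2 z}(e^{√2 z} + 1)`** (`F = u + 1`, `e = 2`, `a e = 2√2 > 1`: fast regime):
the exponential points of `{x₁ = √2 x₀, y₀ = x₀ + y₁ (y₁ + 1)}` are Zariski dense. (new) -/
theorem unprojectedDense_fast_example :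
    UnprojectedDense (movingLineSurface (Real.sqrt 2 : ℝ) 0 Polynomial.X (Polynomial.X + Polynomial.C 1)) :=
  unprojectedDense_movingLine sqrt_two_ne_ratCast 0 (by rw [Polynomial.natDegree_X]; exact one_pos) _

/-- … in particular this equation has a solution. (new) -/
theorem exists_exp_eq_fast_example :
    ∃ z : ℂ, exp z = z + exp ((Real.sqrt 2 : ℝ) * z) * (exp ((Real.sqrt 2 : ℝ) * z) + 1) := by
  obtain ⟨z, hz⟩ := exists_exp_eq_movingLine sqrt_two_ne_ratCast 0
    (by rw [Polynomial.natDegree_X]; exact one_pos) (Polynomial.X + Polynomial.C 1)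
  refine ⟨z, ?_⟩
  rw [hz, Polynomial.eval_X, Polynomial.eval_add, Polynomial.eval_X, Polynomial.eval_C, add_zero]

end Examples

end Summit.Schanuel.Schanuel.Theorems

end
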